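import Mathlib
import Summits.AtomisticToContinuum.Crystallization.Theses.ChessboardParticlePlanes
import Summits.AtomisticToContinuum.Crystallization.Theorems.ChessboardParticlePlanesLjLaminarWindowsGlueLevels
import HarnessLib

/-!
# Rev. 16's density residual implies rev. 17's one-window residual — line `Sketch`, crux
`LjLaminarWindows` (stmt-AtomisticToContinuum-6711), registered stub `stub_oneWindow_of_laminarityAt`

Skeleton rev. 16 of the line reduced the crux to a DENSITY residual: for every thickness `η > 0`, along
every Lennard-Jones ground-state sequence, for all large radii `L` and every `δ > 0`, frequently in `N`
fewer than `δ N` particles `i` have NO unit normal `n` and levels `c : ℤ → ℝ` (consecutive gaps `≥ 3/4`)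
putting every particle of the closed `L`-ball around `xᵢ` within `η` of a level.  Rev. 17 (lead c11)
reduces the crux further to ONE laminar particle-centred window per large radius, frequently in `N`, in
the crux's own `(A, T)` vocabulary.  This file links the two (stub S13 of rev. 17): with `δ = 1`,
frequently in `N` fewer than `N` particles are non-laminar, so SOME particle is laminar in the levels
form, and the landed conversion `laminar_of_levels` (…GlueLevels.lean) turns `(n, c)` into `(A, T)`.
-/

noncomputable section

open scoped BigOperators
open Filter Topology
open Literature.MathematicalPhysics.StatisticalMechanics
open Summit.AtomisticToContinuum.Crystallization.Theorems.ChargedEnergyGapNegative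

namespace Summit.AtomisticToContinuum.Crystallization.Theorems.LjLaminarWindowsSketch

/-- **S13 of skeleton rev. 17 (line `Sketch`) — rev. 16's density residual implies rev. 17's one-window
residual.** Given `η, x, hx`, take `L₁` from the density residual and `L₀ := L₁`; for `L ≥ L₁` use
`δ := 1`: frequently in `N`, fewer than `1 · N` particles are non-`(η, L)`-laminar (levels form), so not
ALL of `Fin N` is non-laminar (`Equiv.subtypeUnivEquiv`, `Nat.card_fin`), i.e. some particle `i` has a
unit normal `n` and levels `c`; `laminar_of_levels` converts `(n, c)` into the isometry `A` and the
`3/4`-separated height set `T = range c`. [folklore] -/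
theorem stub_oneWindow_of_laminarityAt :
    (∀ η : ℝ, 0 < η → ∀ x : (N : ℕ) → (Fin N → EuclideanSpace ℝ (Fin 3)),
      (∀ N, IsGroundState lennardJones (x N)) → ∃ L₁ : ℝ, ∀ L : ℝ, L₁ ≤ L → ∀ δ : ℝ, 0 < δ →
      ∃ᶠ N : ℕ in Filter.atTop, (Nat.card {i : Fin N // ¬ (∃ n : EuclideanSpace ℝ (Fin 3),
        ‖n‖ = 1 ∧ ∃ c : ℤ → ℝ, (∀ k : ℤ, c k + 3 / 4 ≤ c (k + 1)) ∧ ∀ j : Fin N,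
          dist (x N j) (x N i) ≤ L → ∃ k : ℤ, |inner ℝ (x N j - x N i) n - c k| ≤ η)} : ℝ) <
        δ * N) →
    ∀ x : (N : ℕ) → (Fin N → EuclideanSpace ℝ (Fin 3)), (∀ N, IsGroundState lennardJones (x N)) →
      ∀ η : ℝ, 0 < η → ∃ L₀ : ℝ, ∀ L : ℝ, L₀ ≤ L → ∃ᶠ N in Filter.atTop,
        ∃ (i : Fin N) (A : EuclideanSpace ℝ (Fin 3) →ₗᵢ[ℝ] EuclideanSpace ℝ (Fin 3)) (T : Set ℝ),
          (∀ t ∈ T, ∀ t' ∈ T, t ≠ t' → (3 : ℝ) / 4 ≤ |t - t'|) ∧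
          (∀ j : Fin N, dist (x N j) (x N i) ≤ L → ∃ t ∈ T, |(A (x N j - x N i)) 2 - t| ≤ η) := by
  intro hLamAt x hx η hη
  obtain ⟨L₁, hL₁⟩ := hLamAt η hη x hx
  refine ⟨L₁, fun L hL => ?_⟩
  refine (hL₁ L hL 1 one_pos).mono fun N hN => ?_
  obtain ⟨i, n, hn, c, hc, hwin⟩ : ∃ i : Fin N, ∃ n : EuclideanSpace ℝ (Fin 3),
      ‖n‖ = 1 ∧ ∃ c : ℤ → ℝ, (∀ k : ℤ, c k + 3 / 4 ≤ c (k + 1)) ∧ ∀ j : Fin N,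
        dist (x N j) (x N i) ≤ L → ∃ k : ℤ, |inner ℝ (x N j - x N i) n - c k| ≤ η := by
    by_contra hne
    rw [not_exists] at hne
    rw [Nat.card_congr (Equiv.subtypeUnivEquiv hne), Nat.card_fin, one_mul] at hN
    exact lt_irrefl _ hN
  obtain ⟨A, T, hT, hA⟩ := laminar_of_levels (x N) i L η n hn c hc hwin
  exact ⟨i, A, T, hT, hA⟩

end Summit.AtomisticToContinuum.Crystallization.Theorems.LjLaminarWindowsSketch

end
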